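import Mathlib.Analysis.InnerProductSpace.Projection.Reflection
import Mathlib.Analysis.InnerProductSpace.PiL2
import HarnessLib

/-!
# Frames for Osterwalder–Schrader's "Method B": isometries turning a direction into the time axis

Osterwalder–Schrader II (Comm. Math. Phys. 42 (1975)), Ch. V.1, pp. 291–292: real analyticity of
the Schwinger functions in *all* variables is obtained by writing a real neighbourhood of a
configuration `ξ` as `ξ + ∑ u_i^μ e_μ` with `d+1` linearly independent vectors `e_μ` close to
the time axis, and, for each `μ`, passing by Euclidean covariance (E1) to a frame in which
`e_μ` *is* the time axis ("there are rotations `R_μ` … such that `R_μ e_μ = (1,0,0,0)`", (5.6)),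
so that the variables `u_i^μ` become pure time-gap increases and the one-variable continuation
(5.4) by the semigroup applies ((5.7)). This file supplies the elementary Euclidean geometry,
for `E = EuclideanSpace ℝ (Fin n)` with time axis `e₀`:

* `timeAxis` — `e₀`; `frameIso ê` — for a unit vector `ê`, the Householder reflection through the
  bisector hyperplane `(ℝ ∙ (ê − e₀))ᗮ`, a linear isometry with `frameIso ê ê = e₀`
  (`frameIso_apply_self`) and, being an involution, `frameIso ê e₀ = ê`;
* `frameIso_apply_zero` — **the time coordinate in the new frame is the component along `ê`**:
  `(frameIso ê x) 0 = ⟪ê, x⟫`; hence positivity of times in the new frame is positivity of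
  `⟪ê, x⟫` (`frameIso_apply_zero_pos`);
* `inner_pos_of_cone` — **cone condition**: if `x⁰ > c ‖x‖` (`x` in a cone around the time
  axis) and `‖ê − e₀‖ < c`, then `⟪ê, x⟫ > 0`: directions close to the time axis see every
  vector of the cone at positive "time" — OS's `ℝ₊(γ)` versus its dual cone `ℝ₊(π/2 − γ)`.

## References

* K. Osterwalder, R. Schrader, *Axioms for Euclidean Green's functions II*, Comm. Math. Phys.
  42 (1975) 281–305, Ch. V.1 pp. 291–292, (5.5)–(5.7). [OsterwalderSchraderCMP1975]
-/

noncomputable section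

open Submodule
open scoped InnerProductSpace RealInnerProductSpace

namespace Literature.MathematicalPhysics.QuantumFieldTheory.OSFrames

variable {n : ℕ} [NeZero n]

/-- The time axis `e₀` of `ℝⁿ`. [folklore] -/
def timeAxis : EuclideanSpace ℝ (Fin n) := EuclideanSpace.single 0 1

/-- The time coordinate is the component along `e₀`: `⟪e₀, x⟫ = x 0`. [folklore] -/
theorem inner_timeAxis_left (x : EuclideanSpace ℝ (Fin n)) : ⟪timeAxis, x⟫ = x 0 := by
  simp [timeAxis, EuclideanSpace.inner_single_left]

/-- `‖e₀‖ = 1`. [folklore] -/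
@[simp]
theorem norm_timeAxis : ‖(timeAxis : EuclideanSpace ℝ (Fin n))‖ = 1 := by
  rw [norm_eq_sqrt_real_inner, inner_timeAxis_left]
  simp [timeAxis]

/-- **The frame isometry** of a unit vector `ê`: the Householder reflection through
`(ℝ ∙ (ê − e₀))ᗮ`, a linear isometry of `ℝⁿ` exchanging `ê` and `e₀`
(OS II (5.6): "`R_μ e_μ = (1, 0, 0, 0)`"). [cite: OsterwalderSchraderCMP1975, Ch. V.1 eq. (5.6)] -/
def frameIso (ê : EuclideanSpace ℝ (Fin n)) : EuclideanSpace ℝ (Fin n) ≃ₗᵢ[ℝ] EuclideanSpace ℝ (Fin n) :=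
  reflection (ℝ ∙ (ê - timeAxis))ᗮ

/-- The frame isometry takes `ê` to the time axis. [cite: OsterwalderSchraderCMP1975, Ch. V.1 eq. (5.6)] -/
theorem frameIso_apply_self {ê : EuclideanSpace ℝ (Fin n)} (hê : ‖ê‖ = 1) : frameIso ê ê = timeAxis :=
  reflection_sub (by rw [hê, norm_timeAxis])

/-- The frame isometry is an involution. [folklore] -/
theorem frameIso_frameIso (ê x : EuclideanSpace ℝ (Fin n)) : frameIso ê (frameIso ê x) = x :=
  reflection_reflection _ _

/-- The frame isometry takes the time axis back to `ê`. [folklore] -/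
theorem frameIso_apply_timeAxis {ê : EuclideanSpace ℝ (Fin n)} (hê : ‖ê‖ = 1) : frameIso ê timeAxis = ê := by
  conv_lhs => rw [← frameIso_apply_self hê]
  exact frameIso_frameIso ê ê

/-- **The time coordinate in the new frame is the component along `ê`**:
`(frameIso ê x) 0 = ⟪ê, x⟫`. [cite: OsterwalderSchraderCMP1975, Ch. V.1 eqs. (5.5)–(5.7)] -/
theorem frameIso_apply_zero {ê : EuclideanSpace ℝ (Fin n)} (hê : ‖ê‖ = 1) (x : EuclideanSpace ℝ (Fin n)) :
    (frameIso ê x) 0 = ⟪ê, x⟫ := by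
  rw [← inner_timeAxis_left, ← frameIso_apply_self hê, LinearIsometryEquiv.inner_map_map]

/-- Positivity of the new time coordinate. [folklore] -/
theorem frameIso_apply_zero_pos {ê : EuclideanSpace ℝ (Fin n)} (hê : ‖ê‖ = 1) {x : EuclideanSpace ℝ (Fin n)}
    (hx : 0 < ⟪ê, x⟫) : 0 < (frameIso ê x) 0 := by
  rwa [frameIso_apply_zero hê]

/-- **Cone condition**: a direction `ê` within distance `c` of the time axis sees every vector
of the cone `{x | x 0 > c ‖x‖}` at positive time, `⟪ê, x⟫ > 0`
(`⟪ê, x⟫ = x 0 + ⟪ê − e₀, x⟫ ≥ x 0 − ‖ê − e₀‖ ‖x‖`). [cite: OsterwalderSchraderCMP1975, Ch. V.1 p. 291] -/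
theorem inner_pos_of_cone {ê x : EuclideanSpace ℝ (Fin n)} {c : ℝ} (hê : ‖ê - timeAxis‖ < c)
    (hx : c * ‖x‖ < x 0) : 0 < ⟪ê, x⟫ := by
  have h1 : ⟪ê, x⟫ = x 0 + ⟪ê - timeAxis, x⟫ := by
    rw [inner_sub_left, inner_timeAxis_left]; ring
  have h2 : |⟪ê - timeAxis, x⟫| ≤ ‖ê - timeAxis‖ * ‖x‖ := abs_real_inner_le_norm _ _
  have h3 : ‖ê - timeAxis‖ * ‖x‖ ≤ c * ‖x‖ := mul_le_mul_of_nonneg_right hê.le (norm_nonneg _)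
  rw [h1]
  linarith [neg_abs_le ⟪ê - timeAxis, x⟫]

omit [NeZero n] in
/-- The cone condition is stable under addition of vectors seen at nonnegative time: if
`⟪ê, x⟫ > 0` and `⟪ê, y⟫ ≥ 0` then `⟪ê, x + y⟫ > 0` (the shifts `u e_ν`, `u ≥ 0`, of OS's (5.7)). [folklore] -/
theorem inner_add_pos {ê x y : EuclideanSpace ℝ (Fin n)} (hx : 0 < ⟪ê, x⟫) (hy : 0 ≤ ⟪ê, y⟫) :
    0 < ⟪ê, x + y⟫ := by
  rw [inner_add_right]; linarith

/-- **Directions close to the time axis see each other at positive time**: if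
`‖ê − e₀‖ < 1/2` and `‖ê' − e₀‖ < 1/2` with `ê'` a unit vector, then `⟪ê, ê'⟫ > 0` (so
nonnegative combinations `∑ u_ν ê_ν` are seen at nonnegative time from every frame `ê_μ`). [folklore] -/
theorem inner_pos_of_near {ê ê' : EuclideanSpace ℝ (Fin n)} (hê : ‖ê - timeAxis‖ < 1 / 2)
    (hê' : ‖ê' - timeAxis‖ < 1 / 2) (h1 : ‖ê'‖ = 1) : 0 < ⟪ê, ê'⟫ := by
  refine inner_pos_of_cone hê ?_
  -- `ê' 0 = ⟪e₀, ê'⟫ = 1 + ⟪e₀, ê' - e₀⟫ ≥ 1 - ‖ê' - e₀‖ > 1/2 = (1/2) ‖ê'‖`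
  have h2 : ê' 0 = 1 + ⟪(timeAxis : EuclideanSpace ℝ (Fin n)), ê' - timeAxis⟫ := by
    rw [← inner_timeAxis_left, inner_sub_right, real_inner_self_eq_norm_sq, norm_timeAxis]; ring
  have h3 : |⟪(timeAxis : EuclideanSpace ℝ (Fin n)), ê' - timeAxis⟫| ≤ ‖ê' - timeAxis‖ := by
    have h := abs_real_inner_le_norm (timeAxis : EuclideanSpace ℝ (Fin n)) (ê' - timeAxis)
    rwa [norm_timeAxis, one_mul] at h
  rw [h1, mul_one, h2]
  linarith [neg_abs_le ⟪(timeAxis : EuclideanSpace ℝ (Fin n)), ê' - timeAxis⟫]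

end Literature.MathematicalPhysics.QuantumFieldTheory.OSFrames
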